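import Summits.AtomisticToContinuum.Crystallization.Theorems.ChartedPlanarOrderLayerChainLiouvilleTailSlaving

/-!
# Layer-chain Liouville with windows — part 3/3: the ℓ¹ kernel (infinite coupling range, summable weights of finite first moment) = E1 `SlavingKernelL1`
(decomp-a2c lens-3 g22 `LayerChainTail.lean` v3 sha256 89685986…, lines 424–731, split into three modules at the gate's 400-line limit;
content byte-identical; namespace kept `…ChartedPlanarOrderLayerChainLiouvilleTail` throughout).  ★ `slavingL1_translation` is binder-for-binder
the hypothesis list of E1 `SlavingKernelL1` of `…Theorems.ChartedPlanarOrderProfileSlavingLJ`.  Pure Mathlib on top of part 2; def-free; sorry-free.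
-/

noncomputable section

open scoped RealInnerProductSpace

namespace Summit.AtomisticToContinuum.Crystallization.Theorems.ChartedPlanarOrderLayerChainLiouvilleTail

variable {E : Type*} [NormedAddCommGroup E] [InnerProductSpace ℝ E]

/-! ## The ℓ¹ kernel — INFINITE coupling range with summable weights of finite first moment (E1 `SlavingKernelL1` of PS_LJ)
The Lennard-Jones stress across gap `m` feels EVERY increment, with weights `κ j = O(|j|⁻⁷)`.  The finite-range section above is the
template; here `Σ_{|j| ≤ R}` becomes `Σ'_j` under `Summable κ` and `Summable (|j|·κ j)`: the block-shift error `2R·B` becomes `2|j|·B`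
summed against `κ` (the first moment), and the «far enough out» step splits the series into a finite part (eventually small terms) and a
small tail (`tendsto_tsum_compl_atTop_zero`). -/

/-- the weights with the self-coupling removed are nonnegative. -/
theorem ite_weight_nonneg {κ : ℤ → ℝ} (hκ : ∀ j, 0 ≤ κ j) (j : ℤ) : 0 ≤ (if j = 0 then (0 : ℝ) else κ j) := by
  split_ifs
  · exact le_rfl
  · exact hκ j

/-- … and dominated by the weights. -/
theorem ite_weight_le {κ : ℤ → ℝ} (hκ : ∀ j, 0 ≤ κ j) (j : ℤ) : (if j = 0 then (0 : ℝ) else κ j) ≤ κ j := by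
  split_ifs
  · exact hκ j
  · exact le_rfl

/-- … hence summable. -/
theorem summable_ite_weight {κ : ℤ → ℝ} (hκ : ∀ j, 0 ≤ κ j) (hκs : Summable κ) :
    Summable (fun j : ℤ => if j = 0 then (0 : ℝ) else κ j) :=
  Summable.of_nonneg_of_le (ite_weight_nonneg hκ) (ite_weight_le hκ) hκs

/-- `Σ'_{j ≠ 0} κ j = Σ' κ − κ 0`. -/
theorem tsum_ite_weight {κ : ℤ → ℝ} (hκs : Summable κ) : ∑' j : ℤ, (if j = 0 then (0 : ℝ) else κ j) = (∑' j, κ j) - κ 0 := by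
  rw [hκs.tsum_eq_add_tsum_ite 0]
  ring

/-- the first moment does not see the self-coupling. -/
theorem tsum_abs_mul_ite_weight (κ : ℤ → ℝ) :
    ∑' j : ℤ, |(j : ℝ)| * (if j = 0 then (0 : ℝ) else κ j) = ∑' j : ℤ, |(j : ℝ)| * κ j := by
  refine tsum_congr (fun j => ?_)
  split_ifs with hj
  · rw [hj]; simp
  · rfl

/-- **Young against summable weights**: `x·Σ' ω j u j ≤ (Σ' ω)/2 · x² + ½ Σ' ω j u j²` for `0 ≤ u ≤ B`, `ω ≥ 0` summable. -/
theorem mul_tsum_le_young {ω : ℤ → ℝ} (hω : ∀ j, 0 ≤ ω j) (hωs : Summable ω) {u : ℤ → ℝ} (hu : ∀ j, 0 ≤ u j) {B : ℝ}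
    (huB : ∀ j, u j ≤ B) (x : ℝ) :
    x * ∑' j, ω j * u j ≤ (∑' j, ω j) / 2 * x ^ 2 + 1 / 2 * ∑' j, ω j * u j ^ 2 := by
  have hs1 : Summable (fun j => ω j * u j) :=
    Summable.of_nonneg_of_le (fun j => mul_nonneg (hω j) (hu j)) (fun j => mul_le_mul_of_nonneg_left (huB j) (hω j)) (hωs.mul_right B)
  have hs2 : Summable (fun j => ω j * u j ^ 2) :=
    Summable.of_nonneg_of_le (fun j => mul_nonneg (hω j) (sq_nonneg _))
      (fun j => mul_le_mul_of_nonneg_left (pow_le_pow_left₀ (hu j) (huB j) 2) (hω j)) (hωs.mul_right (B ^ 2))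
  have hs3 : Summable (fun j => x * (ω j * u j)) := hs1.mul_left x
  have hs4 : Summable (fun j => x ^ 2 / 2 * ω j + 1 / 2 * (ω j * u j ^ 2)) := (hωs.mul_left _).add (hs2.mul_left _)
  rw [← tsum_mul_left]
  calc ∑' j, x * (ω j * u j) ≤ ∑' j, (x ^ 2 / 2 * ω j + 1 / 2 * (ω j * u j ^ 2)) := by
        refine Summable.tsum_le_tsum (fun j => ?_) hs3 hs4
        have hy := two_mul_le_add_sq x (u j)
        have := hω j
        nlinarith
    _ = x ^ 2 / 2 * ∑' j, ω j + 1 / 2 * ∑' j, ω j * u j ^ 2 := by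
        rw [Summable.tsum_add (hωs.mul_left _) (hs2.mul_left _), tsum_mul_left, tsum_mul_left]
    _ = (∑' j, ω j) / 2 * x ^ 2 + 1 / 2 * ∑' j, ω j * u j ^ 2 := by ring

/- (helper `natAbs_cast_eq_abs : ((j.natAbs : ℕ) : ℝ) = |(j : ℝ)|` omitted at landing — `dedup.landed` ≡
`Literature.NumberTheory.LFunctions.Tao2016.natAbs_cast_eq_abs`; its one use below is inlined as `Nat.cast_natAbs, Int.cast_abs`.) -/

/-- **block sums against shifted summable weights**: `Σ_{m∈[a,b]} Σ'_j ω j f(m+j) ≤ (Σ' ω)·Σ_{m∈[a,b]} f m + 2B·Σ'_j |j| ω j`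
for `0 ≤ f ≤ B` and `ω ≥ 0` with summable first moment. -/
theorem sum_Icc_tsum_shift_le {ω : ℤ → ℝ} (hω : ∀ j, 0 ≤ ω j) (hωs : Summable ω) (hω1 : Summable (fun j : ℤ => |(j : ℝ)| * ω j))
    (f : ℤ → ℝ) (hf : ∀ m, 0 ≤ f m) {B : ℝ} (hB : ∀ m, f m ≤ B) (a b : ℤ) :
    ∑ m ∈ Finset.Icc a b, ∑' j, ω j * f (m + j) ≤
      (∑' j, ω j) * ∑ m ∈ Finset.Icc a b, f m + 2 * B * ∑' j : ℤ, |(j : ℝ)| * ω j := by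
  have hB0 : 0 ≤ B := (hf 0).trans (hB 0)
  have hsm : ∀ m : ℤ, Summable (fun j => ω j * f (m + j)) := fun m =>
    Summable.of_nonneg_of_le (fun j => mul_nonneg (hω j) (hf _)) (fun j => mul_le_mul_of_nonneg_left (hB _) (hω j)) (hωs.mul_right B)
  obtain ⟨T, hT⟩ : ∃ T, T = ∑ m ∈ Finset.Icc a b, f m := ⟨_, rfl⟩
  have hpt : ∀ j : ℤ, ∑ m ∈ Finset.Icc a b, ω j * f (m + j) ≤ T * ω j + 2 * B * (|(j : ℝ)| * ω j) := fun j => by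
    rw [← Finset.mul_sum]
    have hj : j ∈ Finset.Icc (-(j.natAbs : ℤ)) (j.natAbs : ℤ) := by
      rw [Finset.mem_Icc]; constructor <;> omega
    have h1 := sum_Icc_shift_le f hf hB a b j.natAbs hj
    rw [Nat.cast_natAbs, Int.cast_abs, ← hT] at h1
    have := hω j
    have : 0 ≤ |(j : ℝ)| := abs_nonneg _
    nlinarith
  have hright : Summable (fun j : ℤ => T * ω j + 2 * B * (|(j : ℝ)| * ω j)) := (hωs.mul_left T).add (hω1.mul_left _)
  have hleft : Summable (fun j : ℤ => ∑ m ∈ Finset.Icc a b, ω j * f (m + j)) :=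
    Summable.of_nonneg_of_le (fun j => Finset.sum_nonneg (fun m _ => mul_nonneg (hω j) (hf _))) hpt hright
  rw [← Summable.tsum_finsetSum (fun m _ => hsm m), ← hT]
  calc ∑' j, ∑ m ∈ Finset.Icc a b, ω j * f (m + j) ≤ ∑' j : ℤ, (T * ω j + 2 * B * (|(j : ℝ)| * ω j)) :=
        Summable.tsum_le_tsum hpt hleft hright
    _ = T * ∑' j, ω j + 2 * B * ∑' j : ℤ, |(j : ℝ)| * ω j := by
        rw [Summable.tsum_add (hωs.mul_left T) (hω1.mul_left _), tsum_mul_left, tsum_mul_left]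
    _ = (∑' j, ω j) * T + 2 * B * ∑' j : ℤ, |(j : ℝ)| * ω j := by ring

section SlavingL1

variable (Φ : ℤ → (ℤ → E) → E) (W : ℤ → Set E) (κ : ℤ → ℝ)

/-- pointwise energy inequality, ℓ¹ form: `λ‖d m‖² ≤ ⟨σ − σ', d m⟩ + ‖d m‖·Σ'_{j ≠ 0} κ j ‖d (m+j)‖`. -/
theorem slavingL1_pointwise {lam : ℝ}
    (hmono : ∀ m : ℤ, ∀ h : ℤ → E, (∀ k, h k ∈ W k) → ∀ b' ∈ W m,
      lam * ‖h m - b'‖ ^ 2 ≤ ⟪Φ m h - Φ m (Function.update h m b'), h m - b'⟫)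
    (hlip1 : ∀ m : ℤ, ∀ h h' : ℤ → E, (∀ k, h k ∈ W k) → (∀ k, h' k ∈ W k) →
      ‖Φ m h - Φ m h'‖ ≤ ∑' j : ℤ, κ j * ‖h (m + j) - h' (m + j)‖)
    (g g' : ℤ → E) (hg : ∀ k, g k ∈ W k) (hg' : ∀ k, g' k ∈ W k) {σ σ' : E} (hσ : ∀ m, Φ m g = σ) (hσ' : ∀ m, Φ m g' = σ')
    (m : ℤ) :
    lam * ‖g m - g' m‖ ^ 2 ≤ ⟪σ - σ', g m - g' m⟫ +
      ‖g m - g' m‖ * ∑' j : ℤ, (if j = 0 then (0 : ℝ) else κ j) * ‖g (m + j) - g' (m + j)‖ := by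
  obtain ⟨h', hh'⟩ : ∃ h' : ℤ → E, h' = Function.update g m (g' m) := ⟨_, rfl⟩
  have hh'm : h' m = g' m := by rw [hh', Function.update_self]
  have hh'k : ∀ k, k ≠ m → h' k = g k := fun k hk => by rw [hh', Function.update_of_ne hk]
  have hh'W : ∀ k, h' k ∈ W k := fun k => by
    by_cases hk : k = m
    · rw [hk, hh'm]; exact hg' m
    · rw [hh'k k hk]; exact hg k
  have h1 : lam * ‖g m - g' m‖ ^ 2 ≤ ⟪Φ m g - Φ m h', g m - g' m⟫ := by
    rw [hh']; exact hmono m g hg (g' m) (hg' m)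
  have hΦ : Φ m g - Φ m h' = (σ - σ') + (Φ m g' - Φ m h') := by rw [← hσ m, ← hσ' m]; abel
  have hb : ‖Φ m g' - Φ m h'‖ ≤ ∑' j : ℤ, (if j = 0 then (0 : ℝ) else κ j) * ‖g (m + j) - g' (m + j)‖ := by
    have h2 := hlip1 m g' h' hg' hh'W
    have hfun : (fun j : ℤ => κ j * ‖g' (m + j) - h' (m + j)‖) =
        fun j : ℤ => (if j = 0 then (0 : ℝ) else κ j) * ‖g (m + j) - g' (m + j)‖ := by
      funext j
      by_cases hj : j = 0
      · rw [if_pos hj, hj, add_zero, hh'm, sub_self, norm_zero, mul_zero, zero_mul]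
      · rw [if_neg hj, hh'k (m + j) (by omega), norm_sub_rev]
    rw [hfun] at h2
    exact h2
  have h3 : ⟪Φ m g - Φ m h', g m - g' m⟫ ≤ ⟪σ - σ', g m - g' m⟫ + ‖g m - g' m‖ *
      ∑' j : ℤ, (if j = 0 then (0 : ℝ) else κ j) * ‖g (m + j) - g' (m + j)‖ := by
    rw [hΦ, inner_add_left]
    have h4 := real_inner_le_norm (Φ m g' - Φ m h') (g m - g' m)
    nlinarith [norm_nonneg (g m - g' m)]
  exact h1.trans h3

/-- **block energy bound, ℓ¹ form**: `(λ − K)·Σ_{m ∈ [a,b]} ‖d m‖² ≤ D₂‖σ − σ'‖ + K₁ D₂²` uniformly in the block, where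
`K = Σ' κ − κ 0`, `K₁ = Σ' |j| κ j` (first moment) and `D₂` bounds every block sum `‖Σ_{[a,b]} d‖`. -/
theorem slavingL1_block {lam : ℝ} (hκ : ∀ j, 0 ≤ κ j) (hκs : Summable κ) (hκ1 : Summable (fun j : ℤ => |(j : ℝ)| * κ j))
    (hmono : ∀ m : ℤ, ∀ h : ℤ → E, (∀ k, h k ∈ W k) → ∀ b' ∈ W m,
      lam * ‖h m - b'‖ ^ 2 ≤ ⟪Φ m h - Φ m (Function.update h m b'), h m - b'⟫)
    (hlip1 : ∀ m : ℤ, ∀ h h' : ℤ → E, (∀ k, h k ∈ W k) → (∀ k, h' k ∈ W k) →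
      ‖Φ m h - Φ m h'‖ ≤ ∑' j : ℤ, κ j * ‖h (m + j) - h' (m + j)‖)
    (g g' : ℤ → E) (hg : ∀ k, g k ∈ W k) (hg' : ∀ k, g' k ∈ W k) {σ σ' : E} (hσ : ∀ m, Φ m g = σ) (hσ' : ∀ m, Φ m g' = σ')
    {D₂ : ℝ} (hsum : ∀ a b : ℤ, ‖∑ m ∈ Finset.Icc a b, (g m - g' m)‖ ≤ D₂) (a b : ℤ) :
    (lam - ((∑' j, κ j) - κ 0)) * ∑ m ∈ Finset.Icc a b, ‖g m - g' m‖ ^ 2 ≤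
      ‖σ - σ'‖ * D₂ + (∑' j : ℤ, |(j : ℝ)| * κ j) * D₂ ^ 2 := by
  -- the weights without self-coupling
  have hω0 : ∀ j : ℤ, 0 ≤ (if j = 0 then (0 : ℝ) else κ j) := ite_weight_nonneg hκ
  have hωs : Summable (fun j : ℤ => if j = 0 then (0 : ℝ) else κ j) := summable_ite_weight hκ hκs
  have hω1 : Summable (fun j : ℤ => |(j : ℝ)| * (if j = 0 then (0 : ℝ) else κ j)) :=
    Summable.of_nonneg_of_le (fun j => mul_nonneg (abs_nonneg _) (hω0 j))
      (fun j => mul_le_mul_of_nonneg_left (ite_weight_le hκ j) (abs_nonneg _)) hκ1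
  obtain ⟨K, hK⟩ : ∃ K : ℝ, K = ∑' j : ℤ, (if j = 0 then (0 : ℝ) else κ j) := ⟨_, rfl⟩
  have hKeq : (∑' j, κ j) - κ 0 = K := by rw [hK, tsum_ite_weight hκs]
  obtain ⟨K₁, hK₁⟩ : ∃ K₁ : ℝ, K₁ = ∑' j : ℤ, |(j : ℝ)| * κ j := ⟨_, rfl⟩
  have hK₁' : ∑' j : ℤ, |(j : ℝ)| * (if j = 0 then (0 : ℝ) else κ j) = K₁ := by rw [hK₁, tsum_abs_mul_ite_weight]
  obtain ⟨T, hT⟩ : ∃ T, T = ∑ m ∈ Finset.Icc a b, ‖g m - g' m‖ ^ 2 := ⟨_, rfl⟩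
  rw [hKeq, ← hK₁, ← hT]
  have hK0 : 0 ≤ K := by rw [hK]; exact tsum_nonneg hω0
  have hK₁0 : 0 ≤ K₁ := by rw [hK₁]; exact tsum_nonneg (fun j => mul_nonneg (abs_nonneg _) (hκ j))
  have hD0 : 0 ≤ D₂ := (norm_nonneg _).trans (hsum 0 0)
  have hT0 : 0 ≤ T := by rw [hT]; exact Finset.sum_nonneg (fun m _ => sq_nonneg _)
  -- every single increment difference is bounded by D₂ (block of length one)
  have hd : ∀ m, ‖g m - g' m‖ ≤ D₂ := fun m => by
    have := hsum m m; rwa [Finset.Icc_self, Finset.sum_singleton] at this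
  -- sum the pointwise inequality over the block
  have hP := slavingL1_pointwise Φ W κ hmono hlip1 g g' hg hg' hσ hσ'
  have hS1 : lam * T ≤ ∑ m ∈ Finset.Icc a b, ⟪σ - σ', g m - g' m⟫ +
      ∑ m ∈ Finset.Icc a b, ‖g m - g' m‖ *
        ∑' j : ℤ, (if j = 0 then (0 : ℝ) else κ j) * ‖g (m + j) - g' (m + j)‖ := by
    rw [hT, Finset.mul_sum, ← Finset.sum_add_distrib]
    exact Finset.sum_le_sum (fun m _ => hP m)
  -- the stress term telescopes
  have hS2 : ∑ m ∈ Finset.Icc a b, ⟪σ - σ', g m - g' m⟫ ≤ ‖σ - σ'‖ * D₂ := by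
    rw [← inner_sum]
    exact (real_inner_le_norm _ _).trans (mul_le_mul_of_nonneg_left (hsum a b) (norm_nonneg _))
  -- the cross term: Young pointwise, then the shifted block sums against the first moment
  have hY : ∀ m : ℤ, ‖g m - g' m‖ * ∑' j : ℤ, (if j = 0 then (0 : ℝ) else κ j) * ‖g (m + j) - g' (m + j)‖ ≤
      K / 2 * ‖g m - g' m‖ ^ 2 + 1 / 2 * ∑' j : ℤ, (if j = 0 then (0 : ℝ) else κ j) * ‖g (m + j) - g' (m + j)‖ ^ 2 := by
    intro m
    rw [hK]
    exact mul_tsum_le_young hω0 hωs (fun j => norm_nonneg _) (fun j => hd _) _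
  have hY' := Finset.sum_le_sum (fun m (_ : m ∈ Finset.Icc a b) => hY m)
  rw [Finset.sum_add_distrib, ← Finset.mul_sum, ← hT, ← Finset.mul_sum] at hY'
  have hsh := sum_Icc_tsum_shift_le hω0 hωs hω1 (fun m => ‖g m - g' m‖ ^ 2) (fun m => sq_nonneg _)
    (fun m => pow_le_pow_left₀ (norm_nonneg _) (hd m) 2) a b
  rw [← hK, ← hT, hK₁'] at hsh
  -- assemble: lam T ≤ ‖σ−σ'‖ D₂ + K/2 T + 1/2 (K T + 2 D₂² K₁)
  have hS3 : ∑ m ∈ Finset.Icc a b, ‖g m - g' m‖ *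
      ∑' j : ℤ, (if j = 0 then (0 : ℝ) else κ j) * ‖g (m + j) - g' (m + j)‖ ≤ K * T + K₁ * D₂ ^ 2 := by
    nlinarith
  nlinarith

/-- the tail of a convergent series of reals is eventually below any `ε > 0` (off a finite set). -/
theorem exists_finset_tsum_compl_lt (f : ℤ → ℝ) {ε : ℝ} (hε : 0 < ε) :
    ∃ t : Finset ℤ, ∑' j : {j : ℤ // j ∉ t}, f j < ε :=
  ((tendsto_order.1 (tendsto_tsum_compl_atTop_zero f)).2 ε hε).exists

/-- **bounded relative offsets ⇒ EQUAL transmitted stress**, ℓ¹ form. -/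
theorem slavingL1_stress_eq {lam : ℝ} (hκ : ∀ j, 0 ≤ κ j) (hκs : Summable κ) (hκ1 : Summable (fun j : ℤ => |(j : ℝ)| * κ j))
    (hdom : (∑' j, κ j) - κ 0 < lam)
    (hmono : ∀ m : ℤ, ∀ h : ℤ → E, (∀ k, h k ∈ W k) → ∀ b' ∈ W m,
      lam * ‖h m - b'‖ ^ 2 ≤ ⟪Φ m h - Φ m (Function.update h m b'), h m - b'⟫)
    (hlip1 : ∀ m : ℤ, ∀ h h' : ℤ → E, (∀ k, h k ∈ W k) → (∀ k, h' k ∈ W k) →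
      ‖Φ m h - Φ m h'‖ ≤ ∑' j : ℤ, κ j * ‖h (m + j) - h' (m + j)‖)
    (g g' : ℤ → E) (hg : ∀ k, g k ∈ W k) (hg' : ∀ k, g' k ∈ W k) {σ σ' : E} (hσ : ∀ m, Φ m g = σ) (hσ' : ∀ m, Φ m g' = σ')
    {D₂ : ℝ} (hsum : ∀ a b : ℤ, ‖∑ m ∈ Finset.Icc a b, (g m - g' m)‖ ≤ D₂) : σ = σ' := by
  obtain ⟨K, hK⟩ : ∃ K : ℝ, K = (∑' j, κ j) - κ 0 := ⟨_, rfl⟩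
  obtain ⟨K₁, hK₁⟩ : ∃ K₁ : ℝ, K₁ = ∑' j : ℤ, |(j : ℝ)| * κ j := ⟨_, rfl⟩
  rw [← hK] at hdom
  have hgap : 0 < lam - K := by linarith
  have hD0 : 0 ≤ D₂ := (norm_nonneg _).trans (hsum 0 0)
  have hd : ∀ m, ‖g m - g' m‖ ≤ D₂ := fun m => by
    have := hsum m m; rwa [Finset.Icc_self, Finset.sum_singleton] at this
  have hblock := slavingL1_block Φ W κ hκ hκs hκ1 hmono hlip1 g g' hg hg' hσ hσ' hsum
  simp only [← hK, ← hK₁] at hblock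
  have hC : ∀ a b : ℤ, ∑ m ∈ Finset.Icc a b, ‖g m - g' m‖ ^ 2 ≤ (‖σ - σ'‖ * D₂ + K₁ * D₂ ^ 2) / (lam - K) := fun a b => by
    rw [le_div_iff₀ hgap, mul_comm]; exact hblock a b
  by_contra hne
  have hpos : 0 < ‖σ - σ'‖ := norm_pos_iff.2 (sub_ne_zero.2 hne)
  -- a finite set of couplings carrying all but a small tail of the weights
  obtain ⟨t, ht⟩ := exists_finset_tsum_compl_lt κ (show 0 < ‖σ - σ'‖ / (4 * (D₂ + 1)) by positivity)
  obtain ⟨Kt, hKt⟩ : ∃ Kt : ℝ, Kt = ∑ j ∈ t, κ j := ⟨_, rfl⟩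
  have hKt0 : 0 ≤ Kt := by rw [hKt]; exact Finset.sum_nonneg (fun j _ => hκ j)
  -- far enough out, the finitely many coupled differences are small
  obtain ⟨η, hη⟩ : ∃ η : ℝ, η = ‖σ - σ'‖ / (4 * (Kt + 1)) := ⟨_, rfl⟩
  have hη0 : 0 < η := by rw [hη]; positivity
  obtain ⟨N, hN⟩ := eventually_small_of_block_bound (fun m => ‖g m - g' m‖) hC hη0
  obtain ⟨m₀, hm₀⟩ : ∃ m₀ : ℤ, m₀ = (N : ℤ) + (t.sup Int.natAbs : ℕ) + 1 := ⟨_, rfl⟩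
  have hsmall : ∀ j ∈ t, ‖g (m₀ + j) - g' (m₀ + j)‖ < η := fun j hj => by
    have hj : j.natAbs ≤ t.sup Int.natAbs := Finset.le_sup (f := Int.natAbs) hj
    refine hN _ ?_
    have hj' : (j.natAbs : ℤ) ≤ (t.sup Int.natAbs : ℕ) := by exact_mod_cast hj
    rw [abs_of_nonneg (by omega)]
    omega
  -- split the ℓ¹ bound at `m₀` into the finite part and the tail
  have hFs : Summable (fun j : ℤ => κ j * ‖g (m₀ + j) - g' (m₀ + j)‖) :=
    Summable.of_nonneg_of_le (fun j => mul_nonneg (hκ j) (norm_nonneg _))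
      (fun j => mul_le_mul_of_nonneg_left (hd _) (hκ j)) (hκs.mul_right D₂)
  have h1 : ‖σ - σ'‖ ≤ ∑' j : ℤ, κ j * ‖g (m₀ + j) - g' (m₀ + j)‖ :=
    calc ‖σ - σ'‖ = ‖Φ m₀ g - Φ m₀ g'‖ := by rw [hσ, hσ']
      _ ≤ _ := hlip1 m₀ g g' hg hg'
  have h2 := (hFs.sum_add_tsum_subtype_compl t).symm
  have h3 : ∑ j ∈ t, κ j * ‖g (m₀ + j) - g' (m₀ + j)‖ ≤ Kt * η :=
    calc ∑ j ∈ t, κ j * ‖g (m₀ + j) - g' (m₀ + j)‖ ≤ ∑ j ∈ t, κ j * η :=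
          Finset.sum_le_sum (fun j hj => mul_le_mul_of_nonneg_left (hsmall j hj).le (hκ j))
      _ = Kt * η := by rw [← Finset.sum_mul, hKt]
  have h4 : ∑' j : {j : ℤ // j ∉ t}, κ j * ‖g (m₀ + j) - g' (m₀ + j)‖ ≤ D₂ * ∑' j : {j : ℤ // j ∉ t}, κ j := by
    rw [← tsum_mul_left]
    refine Summable.tsum_le_tsum (fun j => ?_) (hFs.subtype _) ((hκs.subtype _).mul_left D₂)
    have := hκ j
    have := hd (m₀ + j)
    show κ j * ‖g (m₀ + j) - g' (m₀ + j)‖ ≤ D₂ * κ j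
    nlinarith
  have h5 : Kt * η ≤ ‖σ - σ'‖ / 4 := by
    rw [hη, show Kt * (‖σ - σ'‖ / (4 * (Kt + 1))) = ‖σ - σ'‖ / 4 * (Kt / (Kt + 1)) by field_simp]
    exact mul_le_of_le_one_right (by positivity) ((div_le_one (by positivity)).2 (by linarith))
  have h6 : D₂ * ∑' j : {j : ℤ // j ∉ t}, κ j ≤ ‖σ - σ'‖ / 4 :=
    calc D₂ * ∑' j : {j : ℤ // j ∉ t}, κ j ≤ D₂ * (‖σ - σ'‖ / (4 * (D₂ + 1))) := mul_le_mul_of_nonneg_left ht.le hD0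
      _ = ‖σ - σ'‖ / 4 * (D₂ / (D₂ + 1)) := by field_simp
      _ ≤ ‖σ - σ'‖ / 4 := mul_le_of_le_one_right (by positivity) ((div_le_one (by positivity)).2 (by linarith))
  have h7 : ‖σ - σ'‖ ≤ ‖σ - σ'‖ / 4 + ‖σ - σ'‖ / 4 := by
    calc ‖σ - σ'‖ ≤ ∑' j : ℤ, κ j * ‖g (m₀ + j) - g' (m₀ + j)‖ := h1
      _ = ∑ j ∈ t, κ j * ‖g (m₀ + j) - g' (m₀ + j)‖ + ∑' j : {j : ℤ // j ∉ t}, κ j * ‖g (m₀ + j) - g' (m₀ + j)‖ := h2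
      _ ≤ Kt * η + D₂ * ∑' j : {j : ℤ // j ∉ t}, κ j := add_le_add h3 h4
      _ ≤ _ := add_le_add h5 h6
  linarith

/-- **ABSTRACT PS, ℓ¹ form = E1 `SlavingKernelL1` of `…ChartedPlanarOrderProfileSlavingLJ`** (windows; INFINITE coupling range with
summable weights of finite first moment; `Σ' κ − κ 0 < λ`): two offset profiles whose increment profiles lie in the windows and are
balanced (constant transmitted stress each), and whose DIFFERENCE IS BOUNDED, differ by a translation.  Binder order = `SlavingKernelL1`. -/
theorem slavingL1_translation {lam : ℝ} (hκ : ∀ j, 0 ≤ κ j) (hκs : Summable κ) (hκ1 : Summable (fun j : ℤ => |(j : ℝ)| * κ j))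
    (hdom : (∑' j, κ j) - κ 0 < lam)
    (hmono : ∀ m : ℤ, ∀ h : ℤ → E, (∀ k, h k ∈ W k) → ∀ b' ∈ W m,
      lam * ‖h m - b'‖ ^ 2 ≤ ⟪Φ m h - Φ m (Function.update h m b'), h m - b'⟫)
    (hlip1 : ∀ m : ℤ, ∀ h h' : ℤ → E, (∀ k, h k ∈ W k) → (∀ k, h' k ∈ W k) →
      ‖Φ m h - Φ m h'‖ ≤ ∑' j : ℤ, κ j * ‖h (m + j) - h' (m + j)‖)
    (w w' : ℤ → E) (hg : ∀ k, w k - w (k - 1) ∈ W k) (hg' : ∀ k, w' k - w' (k - 1) ∈ W k) (σ σ' : E)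
    (hσ : ∀ m, Φ m (fun k => w k - w (k - 1)) = σ) (hσ' : ∀ m, Φ m (fun k => w' k - w' (k - 1)) = σ')
    (D : ℝ) (hD : ∀ m, ‖w m - w' m‖ ≤ D) : ∃ c : E, ∀ m, w' m = w m + c := by
  have hsum : ∀ a b : ℤ, ‖∑ m ∈ Finset.Icc a b, ((w m - w (m - 1)) - (w' m - w' (m - 1)))‖ ≤ 2 * D :=
    norm_sum_Icc_increments_le hD
  have hσσ' : σ = σ' :=
    slavingL1_stress_eq Φ W κ hκ hκs hκ1 hdom hmono hlip1 (fun k => w k - w (k - 1)) (fun k => w' k - w' (k - 1))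
      hg hg' hσ hσ' hsum
  have heq : ∀ m, Φ m (fun k => w k - w (k - 1)) = Φ m (fun k => w' k - w' (k - 1)) := fun m => by rw [hσ, hσ', hσσ']
  -- the sup-norm Lipschitz constant of the outer couplings is `K = Σ' κ − κ 0`
  have hω0 : ∀ j : ℤ, 0 ≤ (if j = 0 then (0 : ℝ) else κ j) := ite_weight_nonneg hκ
  have hωs : Summable (fun j : ℤ => if j = 0 then (0 : ℝ) else κ j) := summable_ite_weight hκ hκs
  have hK0 : 0 ≤ (∑' j, κ j) - κ 0 := by rw [← tsum_ite_weight hκs]; exact tsum_nonneg hω0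
  have hlip : ∀ m : ℤ, ∀ h h' : ℤ → E, (∀ k, h k ∈ W k) → (∀ k, h' k ∈ W k) → h m = h' m →
      ∀ t : ℝ, (∀ k, ‖h k - h' k‖ ≤ t) → ‖Φ m h - Φ m h'‖ ≤ ((∑' j, κ j) - κ 0) * t := by
    intro m h h' hh hh' hm t ht
    have ht0 : 0 ≤ t := (norm_nonneg _).trans (ht 0)
    have h1 := hlip1 m h h' hh hh'
    have hs1 : Summable (fun j : ℤ => κ j * ‖h (m + j) - h' (m + j)‖) :=
      Summable.of_nonneg_of_le (fun j => mul_nonneg (hκ j) (norm_nonneg _))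
        (fun j => mul_le_mul_of_nonneg_left (ht _) (hκ j)) (hκs.mul_right t)
    have h2 : ∑' j : ℤ, κ j * ‖h (m + j) - h' (m + j)‖ ≤ ∑' j : ℤ, (if j = 0 then (0 : ℝ) else κ j) * t := by
      refine Summable.tsum_le_tsum (fun j => ?_) hs1 (hωs.mul_right t)
      by_cases hj : j = 0
      · rw [if_pos hj, hj, add_zero, hm, sub_self, norm_zero, mul_zero, zero_mul]
      · rw [if_neg hj]; exact mul_le_mul_of_nonneg_left (ht _) (hκ j)
    rw [tsum_mul_right, tsum_ite_weight hκs] at h2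
    exact h1.trans h2
  have hd : ∀ m, ‖(w m - w (m - 1)) - (w' m - w' (m - 1))‖ ≤ 2 * D := fun m => by
    have := hsum m m; rwa [Finset.Icc_self, Finset.sum_singleton] at this
  have hgg := layerChainTail_unique Φ W hK0 hdom hmono hlip (fun k => w k - w (k - 1)) (fun k => w' k - w' (k - 1))
    hg hg' hd heq
  exact exists_translation_of_increments_eq (fun m => (congrFun hgg m).symm)

end SlavingL1

end Summit.AtomisticToContinuum.Crystallization.Theorems.ChartedPlanarOrderLayerChainLiouvilleTail

end
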